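import Summits.KontsevichZagierPeriods.KontsevichZagierPeriods.Theorems.LinRedNormalFormHoffmanSpanInKZSpanTransfer
import Summits.KontsevichZagierPeriods.KontsevichZagierPeriods.Theorems.MzvKernelInKZ.Negative.WeightsTwoThree

/-!
# `HoffmanSpanInKZ` (stmt-KontsevichZagierPeriods-15044): negative side — the shape of any refutation

Negative-side support for the crux `LinRedNormalForm.HoffmanSpanInKZ` (cdisprove unit; work file
`Cruxes/HoffmanSpanInKZ/Disproof.lean`).  `not_summit_of_not`: GIVEN Brown's theorem at the value
level (`hoffmanSpan_eq_mzvSpace`, Brown 2012 Thm 1.1 — a named Literature fact used as a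
hypothesis, not proved in the tree), a refutation of the crux refutes the summit
`KontsevichZagierPeriods` (Conjecture 1 as formalised, in its kernel form
`Negative.withoutClosure_iff_summit`): the value of a word generator `[Δ_w, q ω_ε]` is `q ζ(s)`, a
rational combination of Hoffman values of weight `w`, so the corresponding Hoffman combination of
brackets differs from the generator by an element of `ker eval`; a refutation must therefore place
that element outside `KZ.relations` — an additive invariant of the four move sets finer than the
value (`Negative.not_of_separating_invariant`), i.e. a non-motivic obstruction.  Helpers:
`exists_index` (admissible letters come from an admissible index), `eval_zIdx`
(`eval [ζ(u)]_r = r ζ(u)`).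

Sources: F. Brown, *Mixed Tate motives over ℤ*, Ann. of Math. 175 (2012), Thm 1.1; M. Kontsevich,
D. Zagier, *Periods* (2001), §1.2. -/

noncomputable section

namespace Summit.KontsevichZagierPeriods.HoffmanSpanInKZ.Negative

open Set MeasureTheory
open Literature.NumberTheory.Transcendental
open Summit.KontsevichZagierPeriods.MzvKernelInKZ.Negative
open Summit.KontsevichZagierPeriods.MzvKernelInKZ.TwoPosets
open Summit.KontsevichZagierPeriods.LinRedNormalForm.HoffmanSpanInKZ (hoffmanGens zWord_bword_mem_hoffmanGens)
open Summit.KontsevichZagierPeriods.KontsevichZagierPeriods.Theses.LinRedNormalForm (HoffmanSpanInKZ)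

/-! ## §3 Shape of any refutation: the crux follows from the summit and Brown's theorem -/

/-- Every word with admissible letters is the word of an admissible index of the same weight
(`TwoPosets.exists_index_of_adm`, plus the empty word). [folklore] -/
theorem exists_index {w : ℕ} (ε : Fin w → Bool) (hε : Adm ε) :
    ∃ s : List ℕ, MZV.IsAdmissible s ∧ MZV.weight s = w ∧ bword w s = ε := by
  rcases Nat.eq_zero_or_pos w with rfl | hw
  · exact ⟨[], MZV.isAdmissible_nil, rfl, funext fun i => i.elim0⟩
  · obtain ⟨s, hs, hsw, hbw⟩ := exists_index_of_adm hw ε hε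
    refine ⟨s, hs, hsw, funext fun i => ?_⟩
    simp [bword, wordOf, hbw, List.getD_eq_getElem?_getD, i.isLt]

/-- The value of the bracket of an admissible index: `eval [ζ(u)]_r = r · ζ(u)`. [folklore] -/
theorem eval_zIdx {u : List ℕ} (hu : MZV.IsAdmissible u) (r : ℚ) :
    KZ.eval (zIdx u r) = r * multipleZeta u := by
  rw [zIdx_of_adm hu, KZ.eval_of, value_wordRep,
    value_wordRep_eq_multipleZeta u hu _ (adm_bword hu) fun _ => rfl]

/-- **Shape of any refutation.** Given Brown's theorem at the value level
(`hoffmanSpan_eq_mzvSpace`, Brown 2012, Thm 1.1, a named Literature fact), a refutation of the crux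
is a refutation of the summit (Conjecture 1 as formalised, kernel form
`Negative.withoutClosure_iff_summit`): every word generator differs from a rational Hoffman
combination of brackets by an element of `ker eval`, which the summit puts in `KZ.relations`.
[cite: Brown2012, Theorem 1.1] -/
theorem not_summit_of_not (hB : hoffmanSpan_eq_mzvSpace) (h : ¬ HoffmanSpanInKZ) :
    ¬ _root_.KontsevichZagierPeriods := by
  intro hS
  apply h
  have hK : WithoutClosure := withoutClosure_iff_summit.mpr hS
  intro w ε q s hdom hint
  by_cases hε : Adm ε
  swap
  · exact ⟨0, zero_mem _, by simpa using of_mem_relations_of_not_adm s hdom hint hε⟩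
  obtain ⟨sidx, hadm, hsw, hbw⟩ := exists_index ε hε
  have hmem : multipleZeta sidx ∈ hoffmanSpan w := by
    rw [hB w]
    exact Submodule.subset_span ⟨sidx, hadm, hsw, rfl⟩
  obtain ⟨n, f, g, hsum⟩ := Submodule.mem_span_set'.mp hmem
  have hg : ∀ i, ∃ u, MZV.IsHoffman u ∧ MZV.weight u = w ∧ (g i : ℝ) = multipleZeta u :=
    fun i => (g i).2
  choose u hu hwu hgu using hg
  refine ⟨∑ i, zIdx (u i) (q * f i), sum_mem fun i _ => AddSubgroup.subset_closure ?_, ?_⟩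
  · rw [← zWord_bword_eq_zIdx (hwu i)]
    exact zWord_bword_mem_hoffmanGens (hu i) (hwu i) _
  · apply hK
    rw [map_sub, map_sum, sub_eq_zero]
    have h1 : KZ.eval (KZ.of s) = q * multipleZeta sidx := by
      have hr := of_sub_of_wordRep_mem_relations hε s hdom hint
      have h2 := (AddMonoidHom.mem_ker).1 (KZ.relations_le_ker_eval_holds hr)
      rw [map_sub, sub_eq_zero] at h2
      rw [h2, ← zWord_of_adm hε, ← hbw, zWord_bword_eq_zIdx hsw, eval_zIdx hadm]
    rw [h1]
    simp_rw [eval_zIdx (hu _).isAdmissible, ← hgu]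
    rw [← hsum, Finset.mul_sum]
    refine Finset.sum_congr rfl fun i _ => ?_
    rw [Rat.smul_def]
    push_cast
    ring

end Summit.KontsevichZagierPeriods.HoffmanSpanInKZ.Negative
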